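import Mathlib
import HarnessLib
import Literature.Analysis.FluidPDE.Tao2016AveragedNS.LocalCascadeSolutions
import Literature.Analysis.FluidPDE.Tao2016AveragedNS.RenormalisedCascadeWaves
import Literature.Analysis.FluidPDE.Tao2016AveragedNS.ViscousEternalSolutions
import Literature.Analysis.FluidPDE.Tao2016AveragedNS.BoundedEternalSolutions
import Summits.NavierStokesRegularity.NavierStokesRegularity.Theorems.TaoLadderRungTwoBreakNoSurvivingEternalViscBddOneTailSlaving

/-!
# Crux K1ᵛ(1) `TaoLadderRungTwoBreak.NoSurvivingEternalViscBddOne` (stmt-NavierStokesRegularity-20419):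
# the TAIL BARRIER — ORDERED IGNITION and the doubly-exponential leading edge of a bounded admissible
# eternal solution with covariant viscosity `ν̂ ≥ 0` (part 2)

MODEL lattice ODEs only (Tao 2016 §4 in the self-similar log-time variables of §6.4); nothing in this file
is a statement about the Navier–Stokes equations, and no summit or rung LEAF is proved by it
(`--supports stmt-NavierStokesRegularity-20419 --as helper`).  General `m`, any cancelling table, every
`ε₀ > 0`, every `ν̂ ≥ 0` ((ρ0) and (ρ+) at once); `C_A = fluxConst α`, `Λ = bigLam ε₀`.  Continues
`…TailSlaving` (the fence, the past-local slaving `‖W_k‖ ≤ 2ΛC_A (sup_{s≤σ}‖W_{k-1}(s)‖)²` under the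
backscatter margin `4 C_A ‖W_{k+1}‖ ≤ Λ`, and the sign-free growth bound).

* `tail_barrier` — THE TAIL BARRIER (real induction in time over the whole tail `k ≥ n` at once): if the
  tail is quiet at a level `q` with `4 C_A q ≤ Λ` and `2 Λ C_A q² < q` on `(-∞, σ₀]`, and the driver shell
  `n - 1` stays at a sub-ignition level `M`, `2 Λ C_A M² < q`, on `(-∞, σ₁]`, then the whole tail stays
  `≤ q` on `(-∞, σ₁]` (at a quiet time every tail shell is slaved below `max(2ΛC_Aq², 2ΛC_AM²) < q`, and
  the growth bound steps this forward uniformly in the shell — no uniform Lipschitz bound is available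
  for `ν̂ > 0`, the energy form is what makes the step uniform).
* `orderedIgnition_of_quietPast` — ORDERED IGNITION: a tail that was quiet in some past reaches level `q`
  only after the shell just below it has exceeded every sub-ignition level `M < √(q/(2ΛC_A))`.
* `leadingEdge_doublyExponential` — above a driver of size `M` a quiet tail is DOUBLY EXPONENTIALLY small:
  `‖W_{n+j}‖ ≤ (2ΛC_A)⁻¹ (2 Λ C_A M)^{2^{j+1}}` on `(-∞, σ₁]` — the leading edge of a lattice front is sharp,
  at every amplitude of the solution.
* `exists_quietPast_of_visc`, `orderedIgnition_visc`, `loud_downset_visc` — for `ν̂ > 0` the quiet past of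
  EVERY tail is a theorem (tree `farPastDecay_all`), so ordered ignition is UNCONDITIONAL for every
  uniformly bounded admissible viscous eternal solution of a cancelling table, and at the canonical level
  `q₀ = 1/(4Λ(C_A+1))` the LOUD SET IS A DOWN-SET: if shell `k` is loud by log-time `σ₁`, every shell
  `j ≤ k` was loud by `σ₁` — activity always comes up the ladder from `-∞` («no bounded viscous eternal
  solution is lit in the middle»).

READING for the census of ⟨20419⟩ (lineage-1 items (N1)/(N2): front-speed lemma, non-perturbative front
analysis): these lemmas give the FRONT POSITION `n*(σ) = max{k : sup_{s≤σ}‖W_k(s)‖ > q₀}` of a bounded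
admissible eternal solution (a down-set at every log-time, non-decreasing in `σ`) and the doubly-exponential
profile above it, in the renormalised ETERNAL setting and for every `ν̂ ≥ 0` (the tree's
`BlowupRigidityOne.orderedIgnition` is the physical-time statement for exact blow-up flows from one-shell
data; for `ν̂ = 0` the quiet past of a tail is the one hypothesis left standing here).  HONEST LABEL:
structure lemmas; `stub_noSurvivingEternalBddOne`, `stub_noLoudLadderOne` and ⟨20419⟩ stay OPEN; rung 0.
-/

noncomputable section

-- the summit and its single sub-problem share the name (CONVENTIONS §1)
set_option linter.dupNamespace false

namespace Summit.NavierStokesRegularity.NavierStokesRegularity.Theorems.NoSurvivingEternalViscBddOne.TailBarrier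

open Set Filter Topology
open scoped RealInnerProductSpace
open Literature.Analysis.FluidPDE Literature.Analysis.FluidPDE.TaoCascade

variable {m : ℕ} {ε₀ νh : ℝ} {α : Fin m → Fin m → Fin m → ℤ × ℤ × ℤ → ℝ} {W : ℤ → ℝ → Em m}

/-! ## The tail barrier and ordered ignition -/

/-- **THE TAIL BARRIER (any `ν̂ ≥ 0`, no sign hypothesis).**  Let `W` be a uniformly bounded admissible
eternal solution with covariant viscosity of a cancelling table, and `q` a level with `4 C_A q ≤ Λ` and
`2 Λ C_A q² < q`.  If the tail `k ≥ n` is quiet at level `q` on `(-∞, σ₀]` and the driver shell `n - 1` stays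
at a sub-ignition level `M` (`2 Λ C_A M² < q`) on `(-∞, σ₁]`, `σ₀ ≤ σ₁`, then the whole tail stays quiet at
level `q` on `(-∞, σ₁]`.  (Real induction in time over the whole tail at once: at a quiet time every tail
shell is slaved below `max(2ΛC_Aq², 2ΛC_AM²) < q` by `norm_le_slaved`, and `normSq_le_add_mul` steps the
bound forward uniformly in the shell.)
[cite: Tao2016AveragedNS, §4 (4.1), (4.3), Lemma 4.1 (4.8); §5 (the energy moves up one shell at a time); §6.4] -/
theorem tail_barrier (hε : 0 < ε₀) (hW : IsEternalVisc ε₀ νh α W) (hc : IsCancellingCoeff α)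
    (hU : UniformBound W) {n : ℤ} {σ₀ σ₁ q M : ℝ} (h01 : σ₀ ≤ σ₁)
    (hq4 : 4 * fluxConst α * q ≤ bigLam ε₀) (hq2 : 2 * bigLam ε₀ * fluxConst α * q ^ 2 < q)
    (hMq : 2 * bigLam ε₀ * fluxConst α * M ^ 2 < q)
    (hM : ∀ s, s ≤ σ₁ → ‖W (n - 1) s‖ ≤ M)
    (h0 : ∀ k : ℤ, n ≤ k → ∀ s, s ≤ σ₀ → ‖W k s‖ ≤ q) :
    ∀ k : ℤ, n ≤ k → ∀ s, s ≤ σ₁ → ‖W k s‖ ≤ q := by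
  have hΛ : 0 < bigLam ε₀ := bigLam_pos (by linarith)
  have hCA : 0 ≤ fluxConst α := fluxConst_nonneg α
  obtain ⟨B, hB⟩ := hU
  have hq0 : 0 < q := lt_of_le_of_lt (by positivity) hMq
  have hcont : ∀ k : ℤ, Continuous (W k) := fun k =>
    continuous_iff_continuousAt.2 fun x => (hW.law k x).continuousAt
  -- the barrier set, in closed form
  set S : Set ℝ := {t | ∀ k : ℤ, n ≤ k → ∀ r : ℝ, ‖W k (min r t)‖ ≤ q} with hS
  have hSiff : ∀ t, t ∈ S ↔ ∀ k : ℤ, n ≤ k → ∀ s, s ≤ t → ‖W k s‖ ≤ q := by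
    intro t
    constructor
    · intro ht k hk s hs
      have := ht k hk s
      rwa [min_eq_left hs] at this
    · intro ht k hk r
      exact ht k hk (min r t) (min_le_right r t)
  have hSclosed : IsClosed S := by
    have hS' : S = ⋂ k : ℤ, ⋂ (_ : n ≤ k), ⋂ r : ℝ, {t | ‖W k (min r t)‖ ≤ q} := by
      ext t; simp only [hS, mem_setOf_eq, mem_iInter]
    rw [hS']
    refine isClosed_iInter fun k => isClosed_iInter fun _ => isClosed_iInter fun r => ?_
    exact isClosed_le ((hcont k).comp (continuous_const.min continuous_id)).norm continuous_const
  -- real induction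
  have hmem : σ₁ ∈ S := by
    refine IsClosed.mem_of_ge_of_forall_exists_gt (hSclosed.inter isClosed_Icc)
      ((hSiff σ₀).2 h0) h01 ?_
    rintro x ⟨hxS, hx0, hx1⟩
    have hPx := (hSiff x).1 hxS
    -- every tail shell is slaved below q'' < q up to time x
    set q'' : ℝ := max (2 * bigLam ε₀ * fluxConst α * q ^ 2) (2 * bigLam ε₀ * fluxConst α * M ^ 2)
      with hq''
    have hq''q : q'' < q := max_lt hq2 hMq
    have hq''0 : 0 ≤ q'' := le_max_of_le_right (by positivity)
    have hslave : ∀ k : ℤ, n ≤ k → ∀ s, s ≤ x → ‖W k s‖ ≤ q'' := by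
      intro k hk s hs
      have hmar : ∀ s', s' ≤ x → 4 * fluxConst α * ‖W (k + 1) s'‖ ≤ bigLam ε₀ := by
        intro s' hs'
        have h1 := hPx (k + 1) (by omega) s' hs'
        calc 4 * fluxConst α * ‖W (k + 1) s'‖ ≤ 4 * fluxConst α * q :=
              mul_le_mul_of_nonneg_left h1 (by positivity)
          _ ≤ bigLam ε₀ := hq4
      rcases eq_or_lt_of_le hk with hkn | hkn
      · -- the first tail shell: driver n - 1
        subst hkn
        have := norm_le_slaved hε hW hc (fun s' hs' => hM s' (hs'.trans hx1.le)) hmar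
          (fun s' _ => hB n s') s hs
        exact this.trans (le_max_right _ _)
      · -- higher tail shells: driver k - 1 ≥ n is quiet
        have hdrv : ∀ s', s' ≤ x → ‖W (k - 1) s'‖ ≤ q := fun s' hs' => hPx (k - 1) (by omega) s' hs'
        have := norm_le_slaved hε hW hc hdrv hmar (fun s' _ => hB k s') s hs
        exact this.trans (le_max_left _ _)
    -- step forward uniformly in the shell
    set L : ℝ := 2 * fluxConst α * (bigLam ε₀ + (bigLam ε₀)⁻¹) * B ^ 3 with hL
    have hB0 : 0 ≤ B := (norm_nonneg _).trans (hB n x)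
    have hL0 : 0 ≤ L := by positivity
    set δ : ℝ := (q ^ 2 - q'' ^ 2) / (L + 1) with hδ
    have hgap : 0 < q ^ 2 - q'' ^ 2 := by nlinarith
    have hδ0 : 0 < δ := div_pos hgap (by linarith)
    have hLδ : L * δ ≤ q ^ 2 - q'' ^ 2 := by
      rw [hδ, mul_div_assoc']
      rw [div_le_iff₀ (by linarith : (0:ℝ) < L + 1)]
      nlinarith
    set y : ℝ := min σ₁ (x + δ) with hy
    refine ⟨y, (hSiff y).2 ?_, lt_min hx1 (by linarith), min_le_left _ _⟩
    intro k hk s hs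
    rcases le_or_gt s x with hsx | hsx
    · exact (hslave k hk s hsx).trans hq''q.le
    · have h1 := normSq_le_add_mul hε hW hc hB k hsx.le
      have h2 : s - x ≤ δ := by
        have : s ≤ x + δ := hs.trans (min_le_right _ _)
        linarith
      have h3 : ‖W k x‖ ^ 2 ≤ q'' ^ 2 := pow_le_pow_left₀ (norm_nonneg _) (hslave k hk x le_rfl) 2
      have h4 : ‖W k s‖ ^ 2 ≤ q ^ 2 := by
        have : L * (s - x) ≤ L * δ := mul_le_mul_of_nonneg_left h2 hL0
        rw [← hL] at h1
        linarith
      exact (pow_le_pow_iff_left₀ (norm_nonneg _) hq0.le two_ne_zero).1 h4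
  exact (hSiff σ₁).1 hmem

/-- **ORDERED IGNITION (contrapositive of the barrier).**  With `q` as in `tail_barrier`: if the tail `k ≥ n`
of a uniformly bounded admissible eternal solution (any `ν̂ ≥ 0`, cancelling table) was quiet at level `q` in
some past `(-∞, σ₀]`, and some tail shell exceeds `q` at a log-time `s ≤ σ₁` (`σ₀ ≤ σ₁`), then the shell
JUST BELOW the tail exceeded every sub-ignition level `M` (`2 Λ C_A M² < q`) at some log-time `≤ σ₁`:
the tail is lit only from the shell below it.
[cite: Tao2016AveragedNS, §4 (4.1), (4.3), Lemma 4.1 (4.8); §5; §6.4] -/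
theorem orderedIgnition_of_quietPast (hε : 0 < ε₀) (hW : IsEternalVisc ε₀ νh α W)
    (hc : IsCancellingCoeff α) (hU : UniformBound W) {n : ℤ} {σ₀ σ₁ q : ℝ} (h01 : σ₀ ≤ σ₁)
    (hq4 : 4 * fluxConst α * q ≤ bigLam ε₀) (hq2 : 2 * bigLam ε₀ * fluxConst α * q ^ 2 < q)
    (h0 : ∀ k : ℤ, n ≤ k → ∀ s, s ≤ σ₀ → ‖W k s‖ ≤ q)
    {k : ℤ} (hk : n ≤ k) {s : ℝ} (hs : s ≤ σ₁) (hloud : q < ‖W k s‖)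
    {M : ℝ} (hMq : 2 * bigLam ε₀ * fluxConst α * M ^ 2 < q) :
    ∃ s', s' ≤ σ₁ ∧ M < ‖W (n - 1) s'‖ := by
  by_contra hcon
  push Not at hcon
  have := tail_barrier hε hW hc hU h01 hq4 hq2 hMq hcon h0 k hk s hs
  exact absurd hloud (not_lt.2 this)

/-! ## The doubly-exponential leading edge -/

/-- **DOUBLY-EXPONENTIAL LEADING EDGE.**  If on `(-∞, σ₁]` the tail `k ≥ n` of a uniformly bounded admissible
eternal solution (any `ν̂ ≥ 0`, cancelling table) is quiet at a margin level (`‖W_k‖ ≤ q`, `4 C_A q ≤ Λ`) and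
the driver shell obeys `‖W_{n-1}‖ ≤ M`, then `‖W_{n+j}(s)‖ ≤ (2ΛC_A)⁻¹ (2 Λ C_A M)^{2^{j+1}}` for every
`j ≥ 0` and `s ≤ σ₁` (iterated slaving: `a₀ = 2ΛC_A M²`, `a_{j+1} = 2ΛC_A a_j²`).  For `2ΛC_A M < 1` the
profile above the driver is doubly exponentially small — the leading edge of a lattice front is sharp.
[cite: Tao2016AveragedNS, §4 (4.1), (4.3), Lemma 4.1 (4.5), (4.8); §6.4] -/
theorem leadingEdge_doublyExponential (hε : 0 < ε₀) (hW : IsEternalVisc ε₀ νh α W)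
    (hc : IsCancellingCoeff α) (hU : UniformBound W) {n : ℤ} {σ₁ q M : ℝ}
    (hq4 : 4 * fluxConst α * q ≤ bigLam ε₀)
    (hq : ∀ k : ℤ, n ≤ k → ∀ s, s ≤ σ₁ → ‖W k s‖ ≤ q)
    (hM : ∀ s, s ≤ σ₁ → ‖W (n - 1) s‖ ≤ M) :
    ∀ (j : ℕ) (s : ℝ), s ≤ σ₁ →
      ‖W (n + j) s‖ ≤ (2 * bigLam ε₀ * fluxConst α)⁻¹ * (2 * bigLam ε₀ * fluxConst α * M) ^ (2 ^ (j + 1)) := by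
  have hΛ : 0 < bigLam ε₀ := bigLam_pos (by linarith)
  have hCA : 0 ≤ fluxConst α := fluxConst_nonneg α
  obtain ⟨B, hB⟩ := hU
  have hq0 : 0 ≤ q := (norm_nonneg _).trans (hq n le_rfl σ₁ le_rfl)
  set c : ℝ := 2 * bigLam ε₀ * fluxConst α with hcdef
  have hc0 : 0 ≤ c := by positivity
  have hmar : ∀ k : ℤ, n ≤ k → ∀ s', s' ≤ σ₁ → 4 * fluxConst α * ‖W (k + 1) s'‖ ≤ bigLam ε₀ := by
    intro k hk s' hs'
    calc 4 * fluxConst α * ‖W (k + 1) s'‖ ≤ 4 * fluxConst α * q :=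
          mul_le_mul_of_nonneg_left (hq (k + 1) (by omega) s' hs') (by positivity)
      _ ≤ bigLam ε₀ := hq4
  -- the recursion a₀ = c M², a_{j+1} = c a_j², solved by a_j = c⁻¹ (c M)^{2^{j+1}} when c ≠ 0
  rcases eq_or_lt_of_le hc0 with hc00 | hcpos
  · -- degenerate table: C_A = 0, every tail shell vanishes on the past
    intro j s hs
    have hz : ∀ (j : ℕ) (s : ℝ), s ≤ σ₁ → ‖W (n + j) s‖ ≤ 0 := by
      intro j
      induction j with
      | zero =>
        intro s hs
        have h := norm_le_slaved hε hW hc hM (hmar n le_rfl) (fun s' _ => hB n s') s hs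
        have e : n + ((0 : ℕ) : ℤ) = n := by simp
        rw [e]
        have h' : ‖W n s‖ ≤ c * M ^ 2 := by rw [hcdef]; exact h
        calc ‖W n s‖ ≤ c * M ^ 2 := h'
          _ = 0 := by rw [← hc00]; ring
      | succ j ih =>
        intro s hs
        have hdrv : ∀ s', s' ≤ σ₁ → ‖W (n + (j + 1 : ℕ) - 1) s'‖ ≤ 0 := by
          intro s' hs'
          have : n + ((j + 1 : ℕ) : ℤ) - 1 = n + (j : ℕ) := by push_cast; ring
          rw [this]; exact ih s' hs'
        have h := norm_le_slaved hε hW hc hdrv (hmar (n + (j+1 : ℕ)) (by omega))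
          (fun s' _ => hB _ s') s hs
        calc ‖W (n + (j + 1 : ℕ)) s‖ ≤ 2 * bigLam ε₀ * fluxConst α * 0 ^ 2 := h
          _ = 0 := by ring
    calc ‖W (n + j) s‖ ≤ 0 := hz j s hs
      _ ≤ c⁻¹ * (c * M) ^ 2 ^ (j + 1) := by rw [← hc00]; simp
  · have hcne : c ≠ 0 := hcpos.ne'
    intro j
    induction j with
    | zero =>
      intro s hs
      have h := norm_le_slaved hε hW hc hM (hmar n le_rfl) (fun s' _ => hB n s') s hs
      have e : n + ((0 : ℕ) : ℤ) = n := by simp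
      rw [e]
      have h' : ‖W n s‖ ≤ c * M ^ 2 := by rw [hcdef]; exact h
      calc ‖W n s‖ ≤ c * M ^ 2 := h'
        _ = c⁻¹ * (c * M) ^ 2 ^ (0 + 1) := by
            rw [zero_add, pow_one]
            field_simp
    | succ j ih =>
      intro s hs
      set a : ℝ := c⁻¹ * (c * M) ^ 2 ^ (j + 1) with ha
      have hdrv : ∀ s', s' ≤ σ₁ → ‖W (n + (j + 1 : ℕ) - 1) s'‖ ≤ a := by
        intro s' hs'
        have : n + ((j + 1 : ℕ) : ℤ) - 1 = n + (j : ℕ) := by push_cast; ring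
        rw [this]; exact ih s' hs'
      have h := norm_le_slaved hε hW hc hdrv (hmar (n + (j+1 : ℕ)) (by omega))
        (fun s' _ => hB _ s') s hs
      calc ‖W (n + (j + 1 : ℕ)) s‖ ≤ 2 * bigLam ε₀ * fluxConst α * a ^ 2 := h
        _ = c * a ^ 2 := by rw [hcdef]
        _ = c⁻¹ * (c * M) ^ 2 ^ (j + 1 + 1) := by
            have hP : (c * M) ^ 2 ^ (j + 1 + 1) = ((c * M) ^ 2 ^ (j + 1)) ^ 2 := by
              rw [← pow_mul, ← pow_succ]
            rw [hP, ha]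
            field_simp

/-! ## Covariant viscosity: the quiet past is automatic, ordered ignition is unconditional -/

/-- **For `ν̂ > 0` every tail is quiet in the far past.**  A uniformly bounded admissible viscous eternal
solution (`ν̂ > 0`, cancelling table) satisfies, for every shell `n` and every level `q > 0`:
`‖W_k(s)‖ ≤ q` for all `k ≥ n` and all `s ≤ σ₀(n, q)` — from the tree's dissipation-range decay
`farPastDecay_all` (`‖W_k(σ)‖ ≤ C_A Λ B² e^{σ}/(ν̂ (1+ε₀)^{2k})`, antitone in `k`).
[cite: Tao2016AveragedNS, §4 Lemma 4.1 (4.8)–(4.10), Thm. 4.2 (statement shape), §6.4; tree `farPastDecay_all`] -/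
theorem exists_quietPast_of_visc (hε : 0 < ε₀) (hν : 0 < νh) (hW : IsEternalVisc ε₀ νh α W)
    (hc : IsCancellingCoeff α) (hU : UniformBound W) (n : ℤ) {q : ℝ} (hq : 0 < q) :
    ∃ σ₀ : ℝ, ∀ k : ℤ, n ≤ k → ∀ s, s ≤ σ₀ → ‖W k s‖ ≤ q := by
  obtain ⟨B, hB⟩ := hU
  have hx1 : 1 ≤ 1 + ε₀ := by linarith
  have hΛ : 0 < bigLam ε₀ := bigLam_pos (by linarith)
  have hCA : 0 ≤ fluxConst α := fluxConst_nonneg α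
  set K : ℝ := fluxConst α * bigLam ε₀ * B ^ 2 / (νh * (1 + ε₀) ^ ((2 : ℝ) * (n : ℝ))) with hK
  have hpow_n : 0 < (1 + ε₀) ^ ((2 : ℝ) * (n : ℝ)) := Real.rpow_pos_of_pos (by linarith) _
  have hK0 : 0 ≤ K := by positivity
  refine ⟨Real.log (q / (K + 1)), fun k hk s hs => ?_⟩
  have h1 := farPastDecay_all hε hν hW hc hB k s
  have hpow_k : (1 + ε₀) ^ ((2 : ℝ) * (n : ℝ)) ≤ (1 + ε₀) ^ ((2 : ℝ) * (k : ℝ)) := by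
    apply Real.rpow_le_rpow_of_exponent_le hx1
    have : (n : ℝ) ≤ (k : ℝ) := by exact_mod_cast hk
    linarith
  have h2 : fluxConst α * bigLam ε₀ * B ^ 2 * Real.exp s / (νh * (1 + ε₀) ^ ((2 : ℝ) * (k : ℝ)))
      ≤ K * Real.exp s := by
    rw [hK, div_mul_eq_mul_div]
    apply div_le_div_of_nonneg_left (by positivity) (by positivity)
    exact mul_le_mul_of_nonneg_left hpow_k hν.le
  have h3 : Real.exp s ≤ q / (K + 1) := by
    have := Real.exp_le_exp.2 hs
    rwa [Real.exp_log (by positivity)] at this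
  calc ‖W k s‖ ≤ K * Real.exp s := h1.trans h2
    _ ≤ K * (q / (K + 1)) := mul_le_mul_of_nonneg_left h3 hK0
    _ ≤ q := by
        rw [mul_div_assoc']
        rw [div_le_iff₀ (by linarith : (0:ℝ) < K + 1)]
        nlinarith

/-- **ORDERED IGNITION, unconditional for `ν̂ > 0`.**  Let `W` be a uniformly bounded admissible viscous
(`ν̂ > 0`) eternal solution of a cancelling table and `q` a level with `4 C_A q ≤ Λ`, `2 Λ C_A q² < q`,
`q > 0`.  If some shell `k ≥ n` exceeds `q` at a log-time `s ≤ σ₁`, then the shell `n - 1` exceeded every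
sub-ignition level `M` (`2 Λ C_A M² < q`) at some log-time `≤ σ₁`.  Iterating downwards (the
ignition level `√(q/(2ΛC_A))` is `> q`): a shell is lit only after EVERY shell below it was lit — the
activity of a bounded viscous eternal solution always comes up the ladder from `n = -∞`.
[cite: Tao2016AveragedNS, §4 (4.1), (4.3), Lemma 4.1 (4.8)–(4.10); §5; §6.4] -/
theorem orderedIgnition_visc (hε : 0 < ε₀) (hν : 0 < νh) (hW : IsEternalVisc ε₀ νh α W)
    (hc : IsCancellingCoeff α) (hU : UniformBound W) {q : ℝ} (hq0 : 0 < q)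
    (hq4 : 4 * fluxConst α * q ≤ bigLam ε₀) (hq2 : 2 * bigLam ε₀ * fluxConst α * q ^ 2 < q)
    {n k : ℤ} (hk : n ≤ k) {σ₁ s : ℝ} (hs : s ≤ σ₁) (hloud : q < ‖W k s‖)
    {M : ℝ} (hMq : 2 * bigLam ε₀ * fluxConst α * M ^ 2 < q) :
    ∃ s', s' ≤ σ₁ ∧ M < ‖W (n - 1) s'‖ := by
  obtain ⟨σ₀, hσ₀⟩ := exists_quietPast_of_visc hε hν hW hc hU n hq0
  have h0 : ∀ k' : ℤ, n ≤ k' → ∀ s', s' ≤ min σ₀ σ₁ → ‖W k' s'‖ ≤ q :=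
    fun k' hk' s' hs' => hσ₀ k' hk' s' (hs'.trans (min_le_left _ _))
  exact orderedIgnition_of_quietPast hε hW hc hU (min_le_right σ₀ σ₁) hq4 hq2 h0 hk hs hloud hMq

/-- **The loud set is a down-set (ν̂ > 0).**  At the canonical level `q₀ = 1/(4 Λ (C_A + 1))` (which
satisfies both margin conditions), if shell `k` of a uniformly bounded admissible viscous eternal solution of
a cancelling table is loud (`‖W_k(s)‖ > q₀`) at some `s ≤ σ₁`, then EVERY shell `j ≤ k` was loud
(`> q₀`) at some log-time `≤ σ₁`.
[cite: Tao2016AveragedNS, §4 (4.1), (4.3), Lemma 4.1 (4.8)–(4.10); §5; §6.4] -/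
theorem loud_downset_visc (hε : 0 < ε₀) (hν : 0 < νh) (hW : IsEternalVisc ε₀ νh α W)
    (hc : IsCancellingCoeff α) (hU : UniformBound W) {k : ℤ} {σ₁ s : ℝ} (hs : s ≤ σ₁)
    (hloud : 1 / (4 * bigLam ε₀ * (fluxConst α + 1)) < ‖W k s‖) :
    ∀ j : ℤ, j ≤ k → ∃ s', s' ≤ σ₁ ∧ 1 / (4 * bigLam ε₀ * (fluxConst α + 1)) < ‖W j s'‖ := by
  have hΛ1 : 1 ≤ bigLam ε₀ := one_le_bigLam hε.le
  have hΛ : 0 < bigLam ε₀ := by linarith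
  have hCA : 0 ≤ fluxConst α := fluxConst_nonneg α
  set q : ℝ := 1 / (4 * bigLam ε₀ * (fluxConst α + 1)) with hq
  have hden : 0 < 4 * bigLam ε₀ * (fluxConst α + 1) := by positivity
  have hq0 : 0 < q := by rw [hq]; positivity
  have hqd : q * (4 * bigLam ε₀ * (fluxConst α + 1)) = 1 := by
    rw [hq]; field_simp
  -- margin conditions at q
  have hq4 : 4 * fluxConst α * q ≤ bigLam ε₀ := by
    have h1 : 4 * fluxConst α * q ≤ 4 * (fluxConst α + 1) * bigLam ε₀ * q := by
      have : fluxConst α ≤ (fluxConst α + 1) * bigLam ε₀ := by nlinarith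
      nlinarith
    have h2 : 4 * (fluxConst α + 1) * bigLam ε₀ * q = 1 := by linarith [hqd]
    linarith
  have hq2 : 2 * bigLam ε₀ * fluxConst α * q ^ 2 < q := by
    have h1 : 2 * bigLam ε₀ * fluxConst α * q < 1 := by nlinarith
    nlinarith
  -- the same q is a sub-ignition level for itself: 2ΛC_A q² < q
  -- downward induction on the distance k - j
  suffices H : ∀ d : ℕ, ∀ j : ℤ, j = k - d → ∃ s', s' ≤ σ₁ ∧ q < ‖W j s'‖ by
    intro j hj
    obtain ⟨d, hd⟩ : ∃ d : ℕ, j = k - d := ⟨(k - j).toNat, by omega⟩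
    exact H d j hd
  intro d
  induction d with
  | zero =>
    intro j hj
    simp only [Nat.cast_zero, sub_zero] at hj
    subst hj
    exact ⟨s, hs, hloud⟩
  | succ d ih =>
    intro j hj
    obtain ⟨s', hs', hloud'⟩ := ih (k - d) rfl
    have hjn : j = (k - d) - 1 := by rw [hj]; push_cast; ring
    obtain ⟨s'', hs'', h''⟩ := orderedIgnition_visc hε hν hW hc hU hq0 hq4 hq2 (n := k - d)
      le_rfl hs' hloud' hq2
    exact ⟨s'', hs'', by rw [hjn]; exact h''⟩

end Summit.NavierStokesRegularity.NavierStokesRegularity.Theorems.NoSurvivingEternalViscBddOne.TailBarrier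

end
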